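import Summits.HodgeConjecture.CorCM.CommonQuarticCMSubfieldFourfolds
import Literature.NumberTheory.ComplexMultiplication.NonPrimitiveCMTypeInduced
import Literature.AlgebraicGeometry.ComplexMultiplication.SimpleIffPrimitiveCMType
import HarnessLib

/-!
# A type unsplit over EVERY place of a subfield is induced from it; hence for two SIMPLE CM fourfolds over a common
# quartic CM field one common unsplit place already forces an exceptional Hodge class

COR-CM (cell `pub-hodgecm2`, binder seat `b16` gen 49, count-neutral claim PARSHADOW, file F4; theorems only, no
definition, no named fact, no `sorry`).  NEW as stated, hence under `Summits/`.  HONEST FRAMING: exceptional (outside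
`D• ⊗ ℂ`) Hodge classes on products of CM abelian varieties, not claimed algebraic or not; `HC_CM` is neither used nor
asserted.

File F3 (`CommonQuarticCMSubfieldFourfolds`) proves: two CM fields quadratic over a common `k`, types unsplit over a
common place `z₀` AND split over every place outside `{z₀, z̄₀}` ⟹ the pair is degenerate.  This file removes the
second hypothesis for SIMPLE realisations over a QUARTIC CM field `k`:

* §1 **`exists_inducedCMType_eq_of_forall_unsplit`** — for `e : k → K` (any degrees) and a CM type `Φ` of `K` for which
  EVERY place of `k` is unsplit (all extensions of each `z` lie on the same side of `Φ`), `Φ` is INDUCED from `k`: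
  `Φ = Φ₁^K` for the CM type `Φ₁ = {z | the extensions of z lie in Φ}` of `k` (Streng Def. 3.2); consequently
  (`not_isSimple_of_forall_unsplit`, Shimura §8.2 Prop. 26 via the tree's `isSimple_iff_primitive` and
  `exists_ne_of_inducedCMType`) no realisation of `Φ` is simple when `[K:ℚ] > [k:ℚ]`.
* §2 **`not_unsplit_of_isSimple_of_unsplit`** — `k` a totally complex QUARTIC field (its places are two conjugate pairs
  `{z₀, z̄₀}`, `{z, z̄}`), `A` a SIMPLE realisation of `Φ`, `z₀` unsplit ⟹ every place outside `{z₀, z̄₀}` is split;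
  §2b **`smul_eq_of_stabilizer_of_unsplit`** — then every automorphism of `ℂ` stabilising `Φ` fixes `z₀`: the reflex
  field of `(K, Φ)` contains `z₀(k)` (so two types with the same unsplit pair have reflex fields through the CM field
  `z₀(k)` — the structural reason behind F3's "the reflex fields do not meet in a totally real field").
* §3 **`exists_exceptional_prod_simple_fourfolds_of_common_unsplit_place`** — THE `(4,4)` STATEMENT: two simple,
  non-isogenous CM abelian varieties whose CM fields are quadratic over a common quartic CM field `k` (for fourfolds:
  octic fields through `k`) and whose types are unsplit over ONE COMMON place of `k` carry an exceptional Hodge class on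
  some `A_{i₀}^a × A_{i₁}^b`; `B• = D•` fails there; their reflex fields do not meet in a totally real field.  For
  `k` non-Galois this is the type-dependent half of the `(4,4)` cell (the additive half, for different unsplit pairs,
  being the tree's `ReflexFieldsMeetRealCMHodge` when the reflex fields meet in a totally real field).

## References

* [Streng2010] M. Streng, *Complex multiplication of abelian surfaces*, thesis (2010), Ch. I Def. 3.2, Lemma 3.5, (3.6).
* [Shimura1998] G. Shimura, *Abelian Varieties with Complex Multiplication and Modular Functions*, §8.2 Prop. 26, §18.1.
* [Gordon1999HodgeAVSurvey] B. B. Gordon, *A survey of the Hodge conjecture for abelian varieties*, 7.4–7.7, 9.4.3.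
-/

set_option autoImplicit false

noncomputable section

open scoped BigOperators
open CategoryTheory CategoryTheory.Limits NumberField NumberField.ComplexEmbedding Module

namespace Summit.HodgeConjecture.CorCM

open Literature.NumberTheory.ComplexMultiplication
open Literature.AlgebraicGeometry.Motives (AbelianVariety CMType)
open Literature.AlgebraicGeometry.HodgeTheory
open Literature.AlgebraicGeometry.ComplexMultiplication (IsCMTypeRealisation isSimple_iff_primitive)
open Literature.AlgebraicGeometry.VanGeemen1994 (hodgeClassSpan)
open Literature.AlgebraicGeometry.Pohlmann1968
open Literature.Barriers.HodgeConjecture (divisorClassesSpan)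
open scoped Classical

/-! ### §1 A type unsplit over every place of a subfield is induced from that subfield -/

section Induced

variable {k K : Type} [Field k] [NumberField k] [Field K] [NumberField K]

/-- Every place of `k` extends to `K` along `e : k → K` (the fibre has `[K:k] > 0` elements). [cite: Shimura1998, §18.1] -/
theorem exists_comp_eq (e : k →+* K) (z : k →+* ℂ) : ∃ y : K →+* ℂ, y.comp e = z := by
  have h := card_filter_comp_eq_mul_finrank e z
  have hpos : 0 < (Finset.univ.filter fun y : K →+* ℂ => y.comp e = z).card := by
    by_contra h0
    have h0' : (Finset.univ.filter fun y : K →+* ℂ => y.comp e = z).card = 0 := by omega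
    rw [h0', zero_mul] at h
    exact absurd h.symm (ne_of_gt finrank_pos)
  obtain ⟨y, hy⟩ := Finset.card_pos.1 hpos
  exact ⟨y, (Finset.mem_filter.1 hy).2⟩

variable [IsCMField K]

omit [NumberField k] in
/-- **Unsplit at `z` ⟹ unsplit at `z̄`** (`φ ∈ Φ ↔ φ̄ ∉ Φ` and `φ̄ ∘ e = \overline{φ ∘ e}`). [cite: Shimura1998, §18.1] -/
theorem unsplit_conj_of_unsplit (e : k →+* K) (Φ : CMType K) {z : k →+* ℂ}
    (hz : ∀ y y' : K →+* ℂ, y.comp e = z → y'.comp e = z → (y ∈ Φ.1 ↔ y' ∈ Φ.1)) :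
    ∀ y y' : K →+* ℂ, y.comp e = (starRingAut : ℂ ≃+* ℂ) • z → y'.comp e = (starRingAut : ℂ ≃+* ℂ) • z →
      (y ∈ Φ.1 ↔ y' ∈ Φ.1) := by
  have hCM := isCMTypeWith_conj Φ
  have hover : ∀ φ : K →+* ℂ, φ.comp e = (starRingAut : ℂ ≃+* ℂ) • z →
      ((starRingAut : ℂ ≃+* ℂ) • φ).comp e = z := fun φ hφ => by
    rw [conj_smul_comp, hφ, conj_smul_eq_conjugate, conj_smul_eq_conjugate]
    exact ComplexEmbedding.involutive_conjugate k z
  intro y y' hy hy'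
  have h := hz _ _ (hover y hy) (hover y' hy')
  rw [hCM.rho_smul_mem_iff, hCM.rho_smul_mem_iff] at h
  tauto

/-- **A CM type unsplit over EVERY place of a subfield is INDUCED from it** (Streng Def. 3.2: `Φ = {y | y ∘ e ∈ Φ₁}`
for a CM type `Φ₁` of `k`, namely `Φ₁ = {z | the extensions of z lie in Φ}`). [cite: Streng2010, Ch. I Def. 3.2] -/
theorem exists_inducedCMType_eq_of_forall_unsplit (e : k →+* K) (Φ : CMType K)
    (hall : ∀ (z : k →+* ℂ) (y y' : K →+* ℂ), y.comp e = z → y'.comp e = z → (y ∈ Φ.1 ↔ y' ∈ Φ.1)) :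
    ∃ Φ₁ : CMType k, inducedCMType e Φ₁ = Φ := by
  have hCM := isCMTypeWith_conj Φ
  -- the type below: places whose extensions lie in `Φ`
  let S : Set (k →+* ℂ) := {z | ∃ y : K →+* ℂ, y.comp e = z ∧ y ∈ Φ.1}
  have hS : ∀ z : k →+* ℂ, z ∈ S ↔ conjugate z ∉ S := by
    intro z
    have hconj : conjugate z = (starRingAut : ℂ ≃+* ℂ) • z := (conj_smul_eq_conjugate z).symm
    constructor
    · rintro ⟨y, hye, hyΦ⟩ ⟨y', hy'e, hy'Φ⟩
      -- `ȳ'` lies over `z` and outside `Φ`, against unsplitness at `z`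
      have h1 : ((starRingAut : ℂ ≃+* ℂ) • y').comp e = z := by
        rw [conj_smul_comp, hy'e, hconj, conj_smul_eq_conjugate, conj_smul_eq_conjugate]
        exact ComplexEmbedding.involutive_conjugate k z
      have h2 : (starRingAut : ℂ ≃+* ℂ) • y' ∉ Φ.1 := fun h => (hCM.rho_smul_mem_iff y').1 h hy'Φ
      exact h2 ((hall z y _ hye h1).1 hyΦ)
    · intro hnot
      obtain ⟨y', hy'e⟩ := exists_comp_eq e (conjugate z)
      have hy'Φ : y' ∉ Φ.1 := fun h => hnot ⟨y', hy'e, h⟩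
      refine ⟨(starRingAut : ℂ ≃+* ℂ) • y', ?_, (hCM.rho_smul_mem_iff y').2 hy'Φ⟩
      rw [conj_smul_comp, hy'e, hconj, conj_smul_eq_conjugate, conj_smul_eq_conjugate]
      exact ComplexEmbedding.involutive_conjugate k z
  refine ⟨⟨S, hS⟩, Subtype.ext (Set.ext fun y => ?_)⟩
  change (∃ y' : K →+* ℂ, y'.comp e = y.comp e ∧ y' ∈ Φ.1) ↔ y ∈ Φ.1
  exact ⟨fun ⟨y', hy'e, hy'Φ⟩ => (hall _ y' y hy'e rfl).1 hy'Φ, fun hy => ⟨y, rfl, hy⟩⟩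

variable {A : AbelianVariety ℂ} {ι : 𝓞 K →+* End A} {θ : K →+* Module.End ℂ (complexBetti A.X 1)}

/-- **No realisation of a type unsplit over every place of a PROPER subfield is simple** (induced types are imprimitive,
Shimura §8.2 Prop. 26). [cite: Shimura1998, §8.2 Prop. 26] [cite: Streng2010, Ch. I Def. 3.2 and (3.6)] -/
theorem not_isSimple_of_forall_unsplit (e : k →+* K) (hlt : finrank ℚ k < finrank ℚ K) {Φ : CMType K}
    (hA : IsCMTypeRealisation Φ A ι θ)
    (hall : ∀ (z : k →+* ℂ) (y y' : K →+* ℂ), y.comp e = z → y'.comp e = z → (y ∈ Φ.1 ↔ y' ∈ Φ.1)) :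
    ¬ A.IsSimple := by
  obtain ⟨Φ₁, hΦ⟩ := exists_inducedCMType_eq_of_forall_unsplit e Φ hall
  obtain ⟨s, t, hst, hpat⟩ := exists_ne_of_inducedCMType e Φ₁ hlt
  rw [hΦ] at hpat
  intro hS
  exact hst ((isSimple_iff_primitive hA).1 hS s t hpat)

end Induced

/-! ### §2 Over a totally complex quartic field a simple realisation leaves at most one conjugate pair unsplit -/

section Quartic

variable {k K : Type} [Field k] [NumberField k] [IsTotallyComplex k] [Field K] [NumberField K] [IsCMField K]
variable {A : AbelianVariety ℂ} {ι : 𝓞 K →+* End A} {θ : K →+* Module.End ℂ (complexBetti A.X 1)}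

omit [NumberField k] in
/-- No place of a totally complex field is real: `z̄ ≠ z`. [folklore] -/
theorem conj_smul_ne_self (z : k →+* ℂ) : (starRingAut : ℂ ≃+* ℂ) • z ≠ z := fun h =>
  IsTotallyComplex.complexEmbedding_not_isReal z (ComplexEmbedding.isReal_iff.2 ((conj_smul_eq_conjugate z) ▸ h))

omit [NumberField k] [IsTotallyComplex k] in
/-- `\overline{z̄} = z` on places. [folklore] -/
theorem conj_smul_conj_smul (z : k →+* ℂ) : (starRingAut : ℂ ≃+* ℂ) • (starRingAut : ℂ ≃+* ℂ) • z = z := by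
  rw [conj_smul_eq_conjugate, conj_smul_eq_conjugate]
  exact ComplexEmbedding.involutive_conjugate k z

/-- **The places of a totally complex quartic field are `{z₀, z̄₀, z, z̄}`** for any `z ∉ {z₀, z̄₀}`. [folklore] -/
theorem eq_or_eq_conj_of_finrank_eq_four (hk : finrank ℚ k = 4) {z₀ z : k →+* ℂ} (hz : z ≠ z₀)
    (hz' : z ≠ (starRingAut : ℂ ≃+* ℂ) • z₀) (w : k →+* ℂ) (hw : w ≠ z₀) (hw' : w ≠ (starRingAut : ℂ ≃+* ℂ) • z₀) :
    w = z ∨ w = (starRingAut : ℂ ≃+* ℂ) • z := by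
  set c : ℂ ≃+* ℂ := starRingAut with hc
  have h1 : z₀ ≠ c • z₀ := (conj_smul_ne_self z₀).symm
  have h2 : z₀ ≠ c • z := fun h => hz' (by rw [h, conj_smul_conj_smul])
  have h3 : c • z₀ ≠ z := fun h => hz' h.symm
  have h4 : c • z₀ ≠ c • z := fun h => hz (by
    have h' := congrArg (fun t => c • t) h
    simp only [hc, conj_smul_conj_smul] at h'
    exact h'.symm)
  have h5 : z ≠ c • z := (conj_smul_ne_self z).symm
  have hT : ({z₀, c • z₀, z, c • z} : Finset (k →+* ℂ)) = Finset.univ := by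
    apply Finset.eq_univ_of_card
    rw [Finset.card_insert_of_notMem, Finset.card_insert_of_notMem, Finset.card_pair h5, Embeddings.card k ℂ, hk]
    · simp only [Finset.mem_insert, Finset.mem_singleton, not_or]
      exact ⟨h3, h4⟩
    · simp only [Finset.mem_insert, Finset.mem_singleton, not_or]
      exact ⟨h1, hz.symm, h2⟩
  have hwT : w ∈ ({z₀, c • z₀, z, c • z} : Finset (k →+* ℂ)) := hT ▸ Finset.mem_univ w
  simp only [Finset.mem_insert, Finset.mem_singleton] at hwT
  rcases hwT with h | h | h | h
  · exact absurd h hw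
  · exact absurd h hw'
  · exact Or.inl h
  · exact Or.inr h

/-- **A SIMPLE realisation leaves at most one conjugate pair of places unsplit** (`k` totally complex quartic,
`[K:ℚ] > 4`): if `z₀` is unsplit for `Φ`, every place outside `{z₀, z̄₀}` is split — otherwise all four places are
unsplit, `Φ` is induced from `k`, and `A` is not simple. [cite: Shimura1998, §8.2 Prop. 26] [cite: Streng2010, Ch. I Def. 3.2] -/
theorem not_unsplit_of_isSimple_of_unsplit (hk : finrank ℚ k = 4) (e : k →+* K) (hlt : 4 < finrank ℚ K)
    {Φ : CMType K} (hA : IsCMTypeRealisation Φ A ι θ) (hS : A.IsSimple) {z₀ : k →+* ℂ}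
    (hu : ∀ y y' : K →+* ℂ, y.comp e = z₀ → y'.comp e = z₀ → (y ∈ Φ.1 ↔ y' ∈ Φ.1)) (z : k →+* ℂ) (hz : z ≠ z₀)
    (hz' : z ≠ (starRingAut : ℂ ≃+* ℂ) • z₀) :
    ¬ ∀ y y' : K →+* ℂ, y.comp e = z → y'.comp e = z → (y ∈ Φ.1 ↔ y' ∈ Φ.1) := by
  intro huz
  refine not_isSimple_of_forall_unsplit e (hk ▸ hlt) hA (fun w => ?_) hS
  by_cases hw : w = z₀
  · subst hw; exact hu
  by_cases hw' : w = (starRingAut : ℂ ≃+* ℂ) • z₀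
  · subst hw'; exact unsplit_conj_of_unsplit e Φ hu
  rcases eq_or_eq_conj_of_finrank_eq_four hk hz hz' w hw hw' with rfl | rfl
  · exact huz
  · exact unsplit_conj_of_unsplit e Φ huz

end Quartic

/-! ### §2b The stabiliser of the type fixes its unsplit place: the reflex field contains `z₀(k)` -/

section Reflex

variable {k K : Type} [Field k] [NumberField k] [Field K] [NumberField K] [IsCMField K]

omit [NumberField k] [IsCMField K] in
/-- An automorphism stabilising `Φ` preserves the signatures: `n(σ z) = n(z)` (`φ ↦ σ ∘ φ` maps the extensions of `z`
in `Φ` onto the extensions of `σ z` in `Φ`). [cite: Shimura1998, §8.3] -/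
theorem card_filter_comp_mem_smul_of_stabilizer (e : k →+* K) (Φ : CMType K) {σ : ℂ ≃+* ℂ}
    (hσ : ∀ x : K →+* ℂ, σ • x ∈ Φ.1 ↔ x ∈ Φ.1) (z : k →+* ℂ) :
    (Finset.univ.filter fun φ : K →+* ℂ => φ.comp e = σ • z ∧ φ ∈ Φ.1).card =
      (Finset.univ.filter fun φ : K →+* ℂ => φ.comp e = z ∧ φ ∈ Φ.1).card := by
  symm
  refine Finset.card_nbij' (fun φ => σ • φ) (fun φ => σ⁻¹ • φ) ?_ ?_ ?_ ?_
  · intro φ hφ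
    simp only [Finset.mem_coe, Finset.mem_filter, Finset.mem_univ, true_and] at hφ ⊢
    refine ⟨?_, (hσ φ).2 hφ.2⟩
    rw [smul_comp_ringHom, hφ.1]
  · intro φ hφ
    simp only [Finset.mem_coe, Finset.mem_filter, Finset.mem_univ, true_and] at hφ ⊢
    refine ⟨?_, ?_⟩
    · rw [smul_comp_ringHom, hφ.1, inv_smul_smul]
    · have h := hσ (σ⁻¹ • φ)
      rw [smul_inv_smul] at h
      exact h.1 hφ.2
  · intro φ _
    exact inv_smul_smul σ φ
  · intro φ _
    exact smul_inv_smul σ φ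

/-- **The stabiliser of a type with one unsplit pair fixes the unsplit place**: for `K` quadratic over `k`, `z₀` unsplit
for `Φ` and every place outside `{z₀, z̄₀}` split, every automorphism of `ℂ` stabilising `Φ` fixes `z₀` — i.e. THE
REFLEX FIELD OF `(K, Φ)` CONTAINS `z₀(k)` (Shimura: the reflex field is the fixed field of the stabiliser).  The
signature of `z₀` (`0` or `2`) is taken only at `z₀` (`z̄₀` has the complementary one, split places have `1`).
[cite: Shimura1998, §8.3] -/
theorem smul_eq_of_stabilizer_of_unsplit (e : k →+* K) (h2 : finrank ℚ K = 2 * finrank ℚ k) (Φ : CMType K)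
    {z₀ : k →+* ℂ} (hu : ∀ y y' : K →+* ℂ, y.comp e = z₀ → y'.comp e = z₀ → (y ∈ Φ.1 ↔ y' ∈ Φ.1))
    (hs : ∀ z : k →+* ℂ, z ≠ z₀ → z ≠ (starRingAut : ℂ ≃+* ℂ) • z₀ →
      ¬ ∀ y y' : K →+* ℂ, y.comp e = z → y'.comp e = z → (y ∈ Φ.1 ↔ y' ∈ Φ.1))
    {σ : ℂ ≃+* ℂ} (hσ : ∀ x : K →+* ℂ, σ • x ∈ Φ.1 ↔ x ∈ Φ.1) : σ • z₀ = z₀ := by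
  have hn := card_filter_comp_mem_smul_of_stabilizer e Φ hσ z₀
  have h0 := card_filter_comp_mem_of_unsplit e h2 Φ hu
  have hc := card_filter_comp_mem_conj_of_unsplit e h2 Φ hu
  by_contra hne
  by_cases hne' : σ • z₀ = (starRingAut : ℂ ≃+* ℂ) • z₀
  · rw [hne', hc] at hn
    omega
  · have h1 := card_filter_comp_mem_of_split e h2 Φ (hs (σ • z₀) hne hne')
    omega

end Reflex

/-! ### §3 The `(4,4)` statement for simple realisations: one common unsplit place suffices -/

section Varieties

variable {I : Type} {K : I → Type} [∀ i, Field (K i)] [∀ i, NumberField (K i)] [∀ i, IsCMField (K i)] [Fintype I]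
  [Nonempty I] {Φ : ∀ i, CMType (K i)}
variable {A : I → AbelianVariety ℂ} {ι : ∀ i, 𝓞 (K i) →+* End (A i)}
  {θ : ∀ i, K i →+* Module.End ℂ (complexBetti (A i).X 1)}
variable {k : Type} [Field k] [NumberField k] [IsTotallyComplex k]

/-- **Two SIMPLE, NON-ISOGENOUS CM abelian varieties whose CM fields are quadratic over a common totally complex QUARTIC
field `k` and whose types are unsplit over ONE COMMON place `z₀` of `k` carry an exceptional Hodge class on some
`A_{i₀}^a × A_{i₁}^b`** — for CM fourfolds: octic fields through a common quartic CM field, same unsplit place.  (Simplicity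
makes every other place split, §2; then F3 applies.) [cite: Gordon1999HodgeAVSurvey, 7.4–7.7 and 9.4.3]
[cite: Shimura1998, §8.2 Prop. 26] -/
theorem exists_exceptional_prod_simple_fourfolds_of_common_unsplit_place {i₀ i₁ : I} (h01 : i₀ ≠ i₁)
    (hk : finrank ℚ k = 4) (e₀ : k →+* K i₀) (e₁ : k →+* K i₁) (h8₀ : finrank ℚ (K i₀) = 8)
    (h8₁ : finrank ℚ (K i₁) = 8) {z₀ : k →+* ℂ}
    (hu₀ : ∀ y y' : K i₀ →+* ℂ, y.comp e₀ = z₀ → y'.comp e₀ = z₀ → (y ∈ (Φ i₀).1 ↔ y' ∈ (Φ i₀).1))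
    (hu₁ : ∀ y y' : K i₁ →+* ℂ, y.comp e₁ = z₀ → y'.comp e₁ = z₀ → (y ∈ (Φ i₁).1 ↔ y' ∈ (Φ i₁).1))
    (hA : ∀ i, IsCMTypeRealisation (Φ i) (A i) (ι i) (θ i)) (hs : ∀ i, (A i).IsSimple)
    (hniso : ∀ i j, i ≠ j → ¬ AbelianVariety.IsIsogenous (A i) (A j)) :
    ∃ (N : ℕ) (π : Fin N → I) (m : ℕ) (c : complexBetti (⨁ fun j : Fin N => A (π j)).X (2 * m)),
      IsRationalClass c ∧
      IsOfHodgeType (⨁ fun j : Fin N => A (π j)).dim (⨁ fun j : Fin N => A (π j)).X (2 * m) m m c ∧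
      c ∉ divisorClassesSpan (⨁ fun j : Fin N => A (π j)).X (⨁ fun j : Fin N => A (π j)).dim m :=
  exists_exceptional_prod_of_isSimple_of_common_unsplit_place h01 e₀ e₁ (by rw [h8₀, hk]) (by rw [h8₁, hk]) hu₀ hu₁
    (fun z hz hz' => not_unsplit_of_isSimple_of_unsplit hk e₀ (by rw [h8₀]; norm_num) (hA i₀) (hs i₀) hu₀ z hz hz')
    (fun z hz hz' => not_unsplit_of_isSimple_of_unsplit hk e₁ (by rw [h8₁]; norm_num) (hA i₁) (hs i₁) hu₁ z hz hz')
    hA hs hniso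

/-- **`B• = D•` fails on some `A_{i₀}^a × A_{i₁}^b`** under the same hypotheses (simple non-isogenous realisations, octic
fields over a common totally complex quartic field, one common unsplit place). [cite: Gordon1999HodgeAVSurvey, 7.5 and 7.6.1] -/
theorem not_forall_prod_hodgeClassSpan_eq_simple_fourfolds_of_common_unsplit_place {i₀ i₁ : I} (h01 : i₀ ≠ i₁)
    (hk : finrank ℚ k = 4) (e₀ : k →+* K i₀) (e₁ : k →+* K i₁) (h8₀ : finrank ℚ (K i₀) = 8)
    (h8₁ : finrank ℚ (K i₁) = 8) {z₀ : k →+* ℂ}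
    (hu₀ : ∀ y y' : K i₀ →+* ℂ, y.comp e₀ = z₀ → y'.comp e₀ = z₀ → (y ∈ (Φ i₀).1 ↔ y' ∈ (Φ i₀).1))
    (hu₁ : ∀ y y' : K i₁ →+* ℂ, y.comp e₁ = z₀ → y'.comp e₁ = z₀ → (y ∈ (Φ i₁).1 ↔ y' ∈ (Φ i₁).1))
    (hA : ∀ i, IsCMTypeRealisation (Φ i) (A i) (ι i) (θ i)) (hs : ∀ i, (A i).IsSimple)
    (hniso : ∀ i j, i ≠ j → ¬ AbelianVariety.IsIsogenous (A i) (A j)) :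
    ¬ ∀ (N : ℕ) (π : Fin N → I) (m : ℕ),
      hodgeClassSpan (⨁ fun j : Fin N => A (π j)).dim (⨁ fun j : Fin N => A (π j)).X m =
        divisorClassesSpan (⨁ fun j : Fin N => A (π j)).X (⨁ fun j : Fin N => A (π j)).dim m := fun h =>
  not_isNondegenerateFamily_of_common_unsplit_place h01 e₀ e₁ (by rw [h8₀, hk]) (by rw [h8₁, hk]) Φ hu₀ hu₁
    (fun z hz hz' => not_unsplit_of_isSimple_of_unsplit hk e₀ (by rw [h8₀]; norm_num) (hA i₀) (hs i₀) hu₀ z hz hz')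
    (fun z hz hz' => not_unsplit_of_isSimple_of_unsplit hk e₁ (by rw [h8₁]; norm_num) (hA i₁) (hs i₁) hu₁ z hz hz')
    ((CMAlgebra.isNondegenerateFamily_iff_forall_prod_hodgeClassSpan_eq
      (CMAlgebra.isSeparatingFamily_of_isSimple_of_pairwise_not_isIsogenous hA hs hniso) hA).2 h)

/-- **… and the two reflex fields do not meet in a totally real field** (two-slot family, same hypotheses).
[cite: Shimura1998, §8.3] [cite: Gordon1999HodgeAVSurvey, §3 Theorem (proof)] -/
theorem not_exists_smul_eq_conj_simple_fourfolds_of_common_unsplit_place {i₀ i₁ : I} (hI : ∀ j, j = i₀ ∨ j = i₁)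
    (h01 : i₀ ≠ i₁) (hk : finrank ℚ k = 4) (e₀ : k →+* K i₀) (e₁ : k →+* K i₁) (h8₀ : finrank ℚ (K i₀) = 8)
    (h8₁ : finrank ℚ (K i₁) = 8) {z₀ : k →+* ℂ}
    (hu₀ : ∀ y y' : K i₀ →+* ℂ, y.comp e₀ = z₀ → y'.comp e₀ = z₀ → (y ∈ (Φ i₀).1 ↔ y' ∈ (Φ i₀).1))
    (hu₁ : ∀ y y' : K i₁ →+* ℂ, y.comp e₁ = z₀ → y'.comp e₁ = z₀ → (y ∈ (Φ i₁).1 ↔ y' ∈ (Φ i₁).1))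
    (hA : ∀ i, IsCMTypeRealisation (Φ i) (A i) (ι i) (θ i)) (hs : ∀ i, (A i).IsSimple) :
    ¬ ∃ g ∈ Subgroup.closure
        ({s : ℂ ≃+* ℂ | ∀ x : K i₀ →+* ℂ, s • x ∈ (Φ i₀).1 ↔ x ∈ (Φ i₀).1} ∪
          {s : ℂ ≃+* ℂ | ∀ y : K i₁ →+* ℂ, s • y ∈ (Φ i₁).1 ↔ y ∈ (Φ i₁).1}),
      ∀ x : K i₀ →+* ℂ, g • x = (starRingAut : ℂ ≃+* ℂ) • x :=
  not_exists_smul_eq_conj_of_common_unsplit_place hI h01 e₀ e₁ (by rw [h8₀, hk]) (by rw [h8₁, hk]) Φ hu₀ hu₁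
    (fun z hz hz' => not_unsplit_of_isSimple_of_unsplit hk e₀ (by rw [h8₀]; norm_num) (hA i₀) (hs i₀) hu₀ z hz hz')
    (fun z hz hz' => not_unsplit_of_isSimple_of_unsplit hk e₁ (by rw [h8₁]; norm_num) (hA i₁) (hs i₁) hu₁ z hz hz')

end Varieties

end Summit.HodgeConjecture.CorCM

end
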